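import Summits.QuantumFields.YangMills.Theorems.BalabanUVNodesK3V6Defs
import Summits.QuantumFields.YangMills.Theorems.BalabanUVNodesN20ClassLawSeparationFromMomentsFaces

/-!
# BalabanUVNodes ∕ N20·N19′·N21 — A CONDITIONAL NO-GO ON K3⁸ v6's REGISTERED FACE TEXTS (FILE P): at any ONE guarded admissible Stage-13 tuple `(F, θ, h, v)` carrying (B) and the UV
# endpoint, stub 1's slot-keyed rates face `KeyedRatesHolderD4V β rr` and stub 2's faces `KeyedRelWeight cr ∧ KeyedShellWeight cr ∧ KeyedCoreEdgeHolderD4V β cr rr` (K3V6Defs, BY NAME)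
# are JOINTLY FALSE as soon as the spine reading's carriers `cr F θ h.toCore g₀ os` exhibit a two-moment separation of some class statistic, infinitely often in `K`, along a family of
# tuned bare sequences cofinal for `ForSmallCouplings` — MY FILE O with the rates premise discharged by stub 1's face

Cell `pub-ymgap` (HUMAN RULING D-0062 Track A; work-bound push D-0149, director-ym №197), width seat `pub-ymgap-dag-n20-w1` (gen 6) on node N20 = NE7b; key item K3⁸
`SpineGivenEndpointR13SepCoPHV` = stmt-QuantumFields-27366 (skeleton v6 b4e55110ab73e679: `stub_rates13HV`, `stub_expansion13HV`; dag-lead KEY MAP v2, INBOX l.35754: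
`--kind proof --supports 27366 --as helper`); COUNT-NEUTRAL.  Bus: CLAIM-20 ∕ INTENT-25.  THEOREMS ONLY: no `def`, no `instance`, no `notation`, no `sorry`; imports dag-n27-w1's
`…K3V6Defs` (the v6 face predicates BY NAME) and MY FILE O `…N20ClassLawSeparationFromMomentsFaces` (p630554).

WHY.  FILES N∕O typed the caricature-free MOMENT TEST at arbitrary carriers.  Stub 2's v6 text concludes `∃ jc sh cr, PinnedAtLive jc sh cr ∧ KeyedRelWeight cr ∧ KeyedShellWeight cr ∧
KeyedExtractionV cr ∧ KeyedCoreEdgeHolderD4V β cr (rrOfRecord 𝔯 ksel)` from stub 1's `… ∧ KeyedRatesHolderD4V β (rrOfRecord 𝔯 ksel)`.  Read at one tuple: the rates face gives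
`ForSmallCouplings D_v (∀ os, PHolderD4 …)`, the N19′ face gives `ForSmallCouplings D_v (∀ os, PHolderD4 … → ∃ δ, Core … ∧ Summable δ)`; merged (`ForSmallCouplings.and`) they yield the
core with a summable `δ` for all SMALL tuned `g₀` (∃-thresholds `γ₀`, `g₁` — `T4ContinuumYM4Torus` :258), while the N20∕N21 faces hold at EVERY `(g₀, os)`.  Hence the face triple of FILE O
holds at the carriers `cr F θ h.toCore g₀ os` for every small tuned `g₀`; a moment separation there, along a family of tuned `g₀` meeting EVERY threshold (cofinal), is a contradiction.  The
statement keeps `cr` ABSTRACT: a consumer at the record pins `cr` (`PinnedAtLive`) and reads the carriers off dag-n20-d's dictionary (`T`, `A`, `B` of `crOfRecord₁₃V` are dial-free).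
* ★★★ `false_of_facesV_of_cofinal_momentSeparation` — the no-go (≈ 40 binders; conclusion `False`).

HONEST FRAMING.  A CONDITIONAL no-go on HYPOTHESIS SHAPES: the cofinal moment-separation family is a HYPOTHESIS nobody has produced for Bałaban's tower (it would need a two-run MEAN gap and
one-run SPREADS of some keyed-class statistic — e.g. the keyed large-field block count — at the record, hence one-run LOWER bounds on large-field weights, unprinted); (B), END, the guards
and a tuned sequence are HYPOTHESES (K0⁷ ∕ K1⁹ ∕ K2⁹ content).  NOTHING here refutes `stub_expansion13HV` or `stub_rates13HV`: their premises may be uninhabited and the separation may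
fail at the record; this file only records WHAT WOULD refute their conjunction at a tuple.  Nothing read at the record; proves NO estimate of Bałaban's; nothing of Bałaban's asserted or
instantiated.  NE7 ∕ NE7b ∕ NE7c NOT PRINTED for `d = 4`, NOT proved; N19 ∕ N20 ∕ N21 NOT discharged; K3⁸ (27366) ∕ aside K3⁷ (20544) OPEN, no stub claimed or closed; counts unmoved (typed
28∕28 · discharged 5∕27); no count claim.  One finite `𝕋⁴` programme at fixed `ε`, Bałaban AS PRINTED; the YM mass gap (Clay) is NOT proved by any of this — R4 closes the conditional
finite-𝕋⁴ rung `BalabanLadder.UV` only; NOT ℝ⁴, NOT OS.  No decl carries a cite tag.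
-/

set_option autoImplicit false

noncomputable section

open Finset Filter Topology
open Literature.MathematicalPhysics.QuantumFieldTheory.Balaban1983to89
open Literature.MathematicalPhysics.QuantumFieldTheory.Balaban1983to89.T4Continuum
open T4ContinuumYM4Torus (ForSmallCouplings)
open Node00 (Stage13HParams datumOfRecord₁₃SepCoPHV Revision₁₃)
open Summit.QuantumFields.YangMills.Theorems.K3V5Defs
open Summit.QuantumFields.YangMills.Theorems.K3V6Defs
open Summit.QuantumFields.YangMills.BalabanUVNodes.N20ClassLawSeparationFromMomentsFaces (not_faces_of_frequently_momentSeparated)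

namespace Summit.QuantumFields.YangMills.BalabanUVNodes.N20StubFacesVNoGoOfMomentSeparation

/-- ★★★ **K3⁸ v6 STUB 2's FACES + STUB 1's RATES FACE ARE JOINTLY UNSATISFIABLE AT ANY TUPLE WHOSE SPINE-READING CARRIERS SEPARATE IN TWO MOMENTS ALONG A COFINAL TUNED FAMILY**
[folklore ∕ bookkeeping].  Let `cr` be a spine reading, `rr` a rate reading, `β` a Hölder letter, and `(F, θ, h, v)` ONE guarded admissible Stage-13 tuple with separated provisos and a
version slot at which statement (B) and the UV endpoint hold.  IF the slot-keyed rates face `KeyedRatesHolderD4V β rr` (v6 stub 1's last conjunct), the slot-free N20∕N21 faces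
`KeyedRelWeight cr`, `KeyedShellWeight cr` and the slot-keyed N19′ face `KeyedCoreEdgeHolderD4V β cr rr` (three of v6 stub 2's conjuncts) all hold, THEN the carriers `cr F θ h.toCore g₀ os`
cannot exhibit a two-moment separation of some class statistic infinitely often in `K` along a family of tuned bare sequences COFINAL in the sense of `ForSmallCouplings`
(`∀ γ₀ ∃ γ ≤ γ₀ ∀ g₁ ∃ g ≤ g₁ ∃ g₀ tuned ∃ os …`) — MY FILE O `not_faces_of_frequently_momentSeparated` at those carriers, with the rates premise discharged by stub 1's face and the two
`ForSmallCouplings` prefixes merged (`.and`).  Contrapositively: such a cofinal separation at a pinned `cr` REFUTES the conjunction of the registered texts at that tuple. -/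
theorem false_of_facesV_of_cofinal_momentSeparation {β : ℝ} {cr : SpineReading} {rr : RateReadingFn}
    (hR : KeyedRatesHolderD4V β rr) (h20 : KeyedRelWeight cr) (h21 : KeyedShellWeight cr) (h19 : KeyedCoreEdgeHolderD4V β cr rr)
    (F : T4Family) (θ : Stage13HParams F 2) (h : θ.Provisos₁₃SepCoPH F 2) (v : Revision₁₃ F 2 θ h)
    (hG : θ.ZhUnity F 2 ∧ θ.SlotsNondegenerate₁₃ F 2) (hθ : θ.Admissible F 2)
    (hB : B16.EndStatementBPrinted (datumOfRecord₁₃SepCoPHV F 2 θ h v).C) (hE : DagBinding.EndpointExistence (datumOfRecord₁₃SepCoPHV F 2 θ h v).C.toB12)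
    (hsep : ∀ γ₀ : ℝ, 0 < γ₀ → ∃ γ : ℝ, 0 < γ ∧ γ ≤ γ₀ ∧ ∀ g₁ : ℝ, 0 < g₁ → ∃ g : ℝ, 0 < g ∧ g ≤ g₁ ∧
      ∃ g₀ : ℕ → ℝ, (datumOfRecord₁₃SepCoPHV F 2 θ h v).Tuned γ g g₀ ∧ ∃ os : List (ULoop F),
        0 ≤ (cr F θ h.toCore g₀ os).l₀ ∧
        (∀ (K : ℕ) (t : ℝ), |t| ≤ (cr F θ h.toCore g₀ os).l₀ → ∀ τ ∈ (cr F θ h.toCore g₀ os).T K, 0 ≤ (cr F θ h.toCore g₀ os).A K t τ) ∧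
        (∀ (K : ℕ) (t : ℝ), |t| ≤ (cr F θ h.toCore g₀ os).l₀ → ∀ τ ∈ (cr F θ h.toCore g₀ os).T K, 0 ≤ (cr F θ h.toCore g₀ os).B K t τ) ∧
        (∀ (K : ℕ) (t : ℝ), |t| ≤ (cr F θ h.toCore g₀ os).l₀ → 0 < ∑ τ ∈ (cr F θ h.toCore g₀ os).T K, (cr F θ h.toCore g₀ os).A K t τ) ∧
        (∀ (K : ℕ) (t : ℝ), |t| ≤ (cr F θ h.toCore g₀ os).l₀ → 0 < ∑ τ ∈ (cr F θ h.toCore g₀ os).T K, (cr F θ h.toCore g₀ os).B K t τ) ∧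
        (∃ᶠ K in atTop, ∃ (t : ℝ) (f : (cr F θ h.toCore g₀ os).ι → ℝ) (mA mB : ℝ), |t| ≤ (cr F θ h.toCore g₀ os).l₀ ∧ mA ≠ mB ∧
          8 * ((∑ τ ∈ (cr F θ h.toCore g₀ os).T K, (cr F θ h.toCore g₀ os).A K t τ / (∑ σ ∈ (cr F θ h.toCore g₀ os).T K, (cr F θ h.toCore g₀ os).A K t σ) * (f τ - mA) ^ 2) +
            (∑ τ ∈ (cr F θ h.toCore g₀ os).T K, (cr F θ h.toCore g₀ os).B K t τ / (∑ σ ∈ (cr F θ h.toCore g₀ os).T K, (cr F θ h.toCore g₀ os).B K t σ) * (f τ - mB) ^ 2)) ≤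
            (mB - mA) ^ 2)) :
    False := by
  -- the two slot-keyed faces at this tuple, merged under ONE `ForSmallCouplings`
  have hFSC := (hR F θ h v hG hθ hB hE).and (h19 F θ h v hG hθ hB hE)
  obtain ⟨γ₀, hγ₀, hγ⟩ := hFSC
  obtain ⟨γ, hγpos, hγle, hg⟩ := hsep γ₀ hγ₀
  obtain ⟨g₁, hg₁, hg₁'⟩ := hγ γ hγpos hγle
  obtain ⟨g, hgpos, hgle, g₀, htuned, os, hl₀, hA0, hB0, hZA, hZB, hfreq⟩ := hg g₁ hg₁
  obtain ⟨hP, hcore⟩ := hg₁' g hgpos hgle g₀ htuned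
  obtain ⟨δ, hC, hδ⟩ := hcore os (hP os)
  -- the slot-free faces at `(g₀, os)`
  have hW := h20 F θ h.toCore hG hθ g₀ os
  have hSh := h21 F θ h.toCore hG hθ g₀ os
  -- FILE O at the carriers `cr F θ h.toCore g₀ os`
  letI := (cr F θ h.toCore g₀ os).dec
  exact not_faces_of_frequently_momentSeparated (vol := (cr F θ h.toCore g₀ os).vol) hl₀ hA0 hB0 hZA hZB hfreq
    ⟨(cr F θ h.toCore g₀ os).Bad, (cr F θ h.toCore g₀ os).W, (cr F θ h.toCore g₀ os).shA, (cr F θ h.toCore g₀ os).shB, (cr F θ h.toCore g₀ os).Wsh, δ, hW, hSh, hC, hδ⟩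

end Summit.QuantumFields.YangMills.BalabanUVNodes.N20StubFacesVNoGoOfMomentSeparation

end
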